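import Literature.Probability.LatticeModels.StrongHarrisKleitman
import HarnessLib

/-!
# General threshold-sunflower inequality (all `k`, all thresholds `m`)

Helper for crux `stmt-CriticalPhenomena-4575` (LP lane, seat `prim-ineq-gen-1`); companion of
`PercNearOneGluingNoHeavyLowerTailThresholdSunflower.lean` (the `k = 3` instances).  PROVED from the tree's
`prodBernoulli_strongHarris` (Gladkov, BLMS 56 (2024) Thm. 2.1).

For a finite family of increasing events `U i` (`i ∈ T`) of a product measure `μ = prodBernoulli p` on `Set ι`
and a threshold `m`, with the cells
`C_S := {ω | ∀ i ∈ T, (ω ∈ U i ↔ i ∈ S)}` (`S ⊆ T`, `|S| = m`: "exactly the events in `S` hold"),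
`A := {ω | some S' ⊆ T with |S'| ≥ m+1 has all its events holding}` ("at least `m+1` hold") and
`B := {ω | every S' ⊆ T with |S'| ≥ m contains a failing event}` ("at most `m−1` hold"):
`(Σ_S μ(C_S))² − Σ_S μ(C_S)² ≤ 2 μ(A) μ(B)`, i.e. `μ(A) μ(B) ≥ e₂(μ(C_S) : |S| = m)`.
-/

noncomputable section

open MeasureTheory Literature.Probability.LatticeModels

namespace Summit.CriticalPhenomena.PercolationContinuityZ3.Theorems

namespace ThresholdSunflower

variable {ι : Type*} [Finite ι] {κ : Type*}

/-- **Threshold sunflower, general form** (Gladkov 2024 BLMS Thm. 2.1 with top cell "at least `m+1` of the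
`U i` hold", middle cells "exactly the `U i`, `i ∈ S`, hold" for `|S| = m`, bottom cell "at most `m−1` hold"):
for increasing events `U i`, `i ∈ T`, of `μ = prodBernoulli p` and any `m : ℕ` (for `m = 0` both sides vanish),
`(Σ_{S ∈ T.powersetCard m} μ(C_S))² − Σ_S μ(C_S)² ≤ 2 μ(A) μ(B)`.
[cite: Gladkov2024StrongFKG, Thm. 2.1] -/
theorem prodBernoulli_thresholdSunflower [DecidableEq κ] (p : ι → unitInterval) (T : Finset κ)
    (U : κ → Set (Set ι)) (hU : ∀ i ∈ T, IsUpperSet (U i)) (m : ℕ) :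
    (∑ S ∈ T.powersetCard m,
          (prodBernoulli p).real {ω | ∀ i ∈ T, (ω ∈ U i ↔ i ∈ S)}) ^ 2 -
        ∑ S ∈ T.powersetCard m, (prodBernoulli p).real {ω | ∀ i ∈ T, (ω ∈ U i ↔ i ∈ S)} ^ 2 ≤
      2 * ((prodBernoulli p).real {ω | ∃ S' ⊆ T, m + 1 ≤ S'.card ∧ ∀ i ∈ S', ω ∈ U i} *
        (prodBernoulli p).real {ω | ∀ S' ⊆ T, m ≤ S'.card → ∃ i ∈ S', ω ∉ U i}) := by
  classical
  set A : Set (Set ι) := {ω | ∃ S' ⊆ T, m + 1 ≤ S'.card ∧ ∀ i ∈ S', ω ∈ U i} with hA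
  set C : Finset κ → Set (Set ι) := fun S => {ω | ∀ i ∈ T, (ω ∈ U i ↔ i ∈ S)} with hC
  -- the set of events holding at `ω`
  let cnt : Set ι → Finset κ := fun ω => T.filter fun i => ω ∈ U i
  have cnt_sub : ∀ ω, cnt ω ⊆ T := fun ω => Finset.filter_subset _ _
  have mem_cnt : ∀ ω i, i ∈ cnt ω ↔ i ∈ T ∧ ω ∈ U i := fun ω i => Finset.mem_filter
  have cnt_mono : ∀ ω ω' : Set ι, ω ≤ ω' → cnt ω ⊆ cnt ω' := by
    intro ω ω' h i hi
    rw [mem_cnt] at hi ⊢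
    exact ⟨hi.1, hU i hi.1 h hi.2⟩
  -- membership in `C S` for `S ⊆ T` means `cnt ω = S`
  have memC : ∀ S, S ⊆ T → ∀ ω, ω ∈ C S ↔ cnt ω = S := by
    intro S hS ω
    simp only [hC, Set.mem_setOf_eq]
    constructor
    · intro h
      ext i
      rw [mem_cnt]
      constructor
      · rintro ⟨hiT, hiU⟩; exact (h i hiT).1 hiU
      · intro hiS; exact ⟨hS hiS, (h i (hS hiS)).2 hiS⟩
    · intro h i hiT
      rw [← h, mem_cnt]
      exact ⟨fun hiU => ⟨hiT, hiU⟩, fun hh => hh.2⟩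
  have memA : ∀ ω, ω ∈ A ↔ m + 1 ≤ (cnt ω).card := by
    intro ω
    simp only [hA, Set.mem_setOf_eq]
    constructor
    · rintro ⟨S', hS'T, hcard, hall⟩
      have hsub : S' ⊆ cnt ω := fun i hi => (mem_cnt ω i).2 ⟨hS'T hi, hall i hi⟩
      exact hcard.trans (Finset.card_le_card hsub)
    · intro h
      exact ⟨cnt ω, cnt_sub ω, h, fun i hi => ((mem_cnt ω i).1 hi).2⟩
  have hdisj : ∀ S ∈ T.powersetCard m, ∀ S' ∈ T.powersetCard m, S ≠ S' → Disjoint (C S) (C S') := by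
    intro S hS S' hS' hne
    have hST := (Finset.mem_powersetCard.1 hS).1
    have hS'T := (Finset.mem_powersetCard.1 hS').1
    exact Set.disjoint_left.2 fun ω h h' =>
      hne (((memC S hST ω).1 h).symm.trans ((memC S' hS'T ω).1 h'))
  have hdisjA : ∀ S ∈ T.powersetCard m, Disjoint A (C S) := by
    intro S hS
    obtain ⟨hST, hcard⟩ := Finset.mem_powersetCard.1 hS
    refine Set.disjoint_left.2 fun ω hωA hωC => ?_
    have h1 := (memA ω).1 hωA
    rw [(memC S hST ω).1 hωC, hcard] at h1
    omega
  have hAup : IsUpperSet A := by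
    intro ω ω' hle hω
    rw [memA] at hω ⊢
    exact hω.trans (Finset.card_le_card (cnt_mono ω ω' hle))
  have hup : ∀ S ∈ T.powersetCard m, IsUpperSet (A ∪ C S) := by
    intro S hS
    obtain ⟨hST, hcard⟩ := Finset.mem_powersetCard.1 hS
    intro ω ω' hle hω
    rcases hω with hω | hω
    · exact Or.inl (hAup hle hω)
    · have hS' : cnt ω = S := (memC S hST ω).1 hω
      have hsub : S ⊆ cnt ω' := hS' ▸ cnt_mono ω ω' hle
      by_cases heq : cnt ω' = S
      · exact Or.inr ((memC S hST ω').2 heq)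
      · left
        rw [memA]
        have hlt : S.card < (cnt ω').card :=
          Finset.card_lt_card (Finset.ssubset_iff_subset_ne.2 ⟨hsub, fun h => heq h.symm⟩)
        omega
  have key := prodBernoulli_strongHarris p (T.powersetCard m) hdisj hdisjA hup hAup
  -- identify the bottom cell
  have hB : (A ∪ ⋃ S ∈ T.powersetCard m, C S)ᶜ = {ω | ∀ S' ⊆ T, m ≤ S'.card → ∃ i ∈ S', ω ∉ U i} := by
    ext ω
    simp only [Set.mem_compl_iff, Set.mem_union, Set.mem_iUnion, exists_prop, not_or, not_exists,
      not_and, Set.mem_setOf_eq]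
    constructor
    · rintro ⟨hnA, hnC⟩ S' hS'T hcard
      by_contra hcon
      push Not at hcon
      have hsub : S' ⊆ cnt ω := fun i hi => (mem_cnt ω i).2 ⟨hS'T hi, hcon i hi⟩
      have hle : m ≤ (cnt ω).card := hcard.trans (Finset.card_le_card hsub)
      have hnA' : ¬ m + 1 ≤ (cnt ω).card := fun h => hnA ((memA ω).2 h)
      have heq : (cnt ω).card = m := by omega
      have hmem : cnt ω ∈ T.powersetCard m := Finset.mem_powersetCard.2 ⟨cnt_sub ω, heq⟩
      exact hnC (cnt ω) hmem ((memC (cnt ω) (cnt_sub ω) ω).2 rfl)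
    · intro h
      constructor
      · intro hωA
        obtain ⟨S', hS'T, hcard, hall⟩ := hωA
        obtain ⟨i, hi, hiU⟩ := h S' hS'T (by omega)
        exact hiU (hall i hi)
      · intro S hS hωC
        obtain ⟨hST, hcard⟩ := Finset.mem_powersetCard.1 hS
        obtain ⟨i, hi, hiU⟩ := h S hST (by omega)
        exact hiU ((hωC i (hST hi)).2 hi)
  rw [hB] at key
  exact key

end ThresholdSunflower

end Summit.CriticalPhenomena.PercolationContinuityZ3.Theorems

end
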